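import Literature.MathematicalPhysics.QuantumFieldTheory.Balaban1983to89.B8LeafKnitZd3CubBdry4
import Literature.MathematicalPhysics.QuantumFieldTheory.Balaban1983to89.B9SupplySockB9P3ZdAtFamilies
import Literature.MathematicalPhysics.QuantumFieldTheory.Balaban1983to89.B8LeafModelZdOfHFP

/-!
# `Balaban1983to89.B8Prop6CubeMemberOfThm33` — [Balaban1985RegularSpaces] PROPOSITION 6 (p. 99) AT THE CUBE FAMILIES OF (1.131) WITH BOTH
# (1.59) SOCKETS SERVED FROM [4] THEOREM 3.3 BY NAME — the N06 → N05 junction in the repaired currency, knitted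

statement-level skeleton of published theorems with citation tags; proofs where landed; nothing here is a claim about the
Yang–Mills mass gap

`[Balaban1985RegularSpaces]` CMP **99** (1985): Prop. 6 p. 99, Thm 4 p. 88, Prop. 3 p. 87, Prop. 5 p. 94, (1.58)–(1.59) p. 86, (1.131) p. 99;
[4] = `[Balaban1985BackgroundPropagators]` Thm 3.3 p. 399, (3.27) p. 395, (3.47) p. 398.

CITATION HEADER (lean-in-tree rule).  Cell `pub-ymgap` (D-0062), node N05 = [B8], seat `pub-ymgap-dag-n05-e` g7 (R141 (C) row s3b).  WHY: the p6
letter of record in the repaired currency, `B8LeafKnitZd3CubBdry4.prop6Printed_zdCub_bdry₅_d4` (this seat), puts `B8.Prop6Printed` on the cube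
members `Node00.zdCub` modulo FIVE per-member sockets: Proposition 5 ∃ base ∕ ∃ step ∕ uniqueness (`SockP5base`, `SockP5`, `SockP5u`) and the
two (1.59) sockets WITH exterior data — `SH59D` (Theorem 4's frame, on the cube sub-family) and the four-line Prop.-3-frame socket at every
cube.  The N06 junction seat (dag-n06-b g5, `B9SupplySockB9P3ZdOmega`, p525454) SERVES both from [4] THEOREM 3.3 BY NAME (`B9.Thm33Printed`)
plus the [4]-letter binders of printed shape on print's class `E(Ω₀)`, in their MEMBER-LOCAL forms (`DictAt`, `Prop6At`, `InvAt`,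
`CurvAt`, `LandauAt`, `AvgAt` — dag-n06-b's `B9SupplySockB9P3ZdAt`; the ∀-member forms are uninhabitable at the J2′ member, their LOCATED-SELF
l.19290): `sockB9P3D4_allLevels_of_thm33_on` (the four-line socket `SockB9P3D4` at every member of an index map with `Margin2`, every level) and
`sockH59D_of_allLevelsD4` (⇒ `SH59D`).  THIS FILE knits them: ★★ `prop6Printed_zdCub_of_thm33` — `B8.Prop6Printed d L (5dL·B₀ᴰ) c₁` on
`zdCub ∘ f` for EVERY cube index `f`, from `B9.Thm33Printed` + the six binders + the three Proposition-5 sockets on the cube sub-family at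
Thm 3.3's constant `B₀ᴰ = max{1, 2B₀max{1,q}}`, under the exterior-bookkeeping window `80d + 8 ≤ dL − 1` (the junction's `B_∂ = (20d+2)B₀ᴰ`
against this seat's absorption `4B_∂ ≤ (dL − 1)B₀ᴰ`).  Proof: ONE call of the junction over the cube sub-family index (so both sockets carry
the SAME `B₀ᴰ`, `cP`; law-abiding members only), the cube member of a cube built field-by-field (n05-c's five laws) IS in that sub-family,
thresholds merged by the sockets' antitonicity.
Kind «kernel-checked proof», theorems only, no `def`.

HONEST SCOPE.  (i) A by-name knit: nothing of [4] is proved — Theorem 3.3 enters as the named hypothesis `B9.Thm33Printed`, its [4] letters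
as binders of printed shape (satisfiable by print's objects iff [4] Sect. A + Thm 3.3 hold at the law-abiding members — N06's object, not
claimed); Proposition 5's three sockets stay HYPOTHESES (the flat-line files `B8Prop6CubeMemberFlatScalarBdry` … address them at `U₀ = 1`).
(ii) The «`L` large» window `80d + 8 ≤ dL − 1` is the tree's exterior bookkeeping (print keeps `A′` on the `Ω₀`-bonds, p. 77), displayed.
(iii) `B₁ = 5dL·B₀ᴰ` with Thm 3.3's `B₀` inside `B₀ᴰ` — print's «B₀ … the corresponding norms of G(U₀), H(U₀)» (p. 87).  Count-neutral;
N05 ∕ N06 NOT discharged; one finite `𝕋⁴` programme at fixed `ε`, Bałaban as printed; nothing continuum ∕ ℝ⁴ ∕ OS ∕ mass-gap ∕ Clay.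
No `sorry`, no `def`, no `instance`, no `notation`.  Unit `pub-ymgap-dag-n05-e` (g7), 2026-08-27.
-/

noncomputable section

open NormedSpace

namespace Literature.MathematicalPhysics.QuantumFieldTheory.Balaban1983to89.B8Prop6CubeMemberOfThm33

open B7Prop1Explicit B7Prop2Explicit B7Prop1Local B7Eq92Concrete
open B8LeafModelZd (ZdIdx SockP5base SockP5 SockP5u)
open B8LeafModelZdOfHFP (sockP5base_anti sockP5_anti sockP5u_anti)
open B8Eq131CubesAdmissible (cubeFam)
open B8CubeMemberZd (cubeLamS cubeLamB hΩ_cubeFam hbox_cubeLamB hclass_cubeLamB htower_cubeLam hpart_cubeLam)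
open B9SupplySockB9P3ZdLetters (OpsZd DictGlob Prop6Feed)
open B9SupplySockB9P3ZdLettersOmega (Margin2 SockB9P3D4 margin2_cubeFam)
open B9SupplySockB9P3ZdOmega (sockH59D_of_allLevelsD4)
open B9SupplySockB9P3ZdAt (DictAt Prop6At InvAt CurvAt LandauAt AvgAt)
open B9SupplySockB9P3ZdAtFamilies (sockB9P3D4_allLevels_of_thm33_on)
open B8LeafKnitZd3CubBdry4 (prop6Printed_zdCub_bdry₅_d4)
open Node00 (CubeB8 zdCub)

-- `Site` alone could resolve to the torus sites of `Setup.lean`; re-export the `ℤ^d` sites of `B7Prop1Explicit`.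
export B7Prop1Explicit (Site)

variable {d : ℕ}

variable {𝔸 : Type} [CStarAlgebra 𝔸] [Nontrivial 𝔸]

/-! ## Proposition 6 on the cube members from Theorem 3.3 by name + the [4]-letter binders + Proposition 5's sockets -/

/-- ★★ **PROPOSITION 6 (p. 99) ON THE CUBE MEMBERS `Node00.zdCub ∘ f`, BOTH (1.59) SOCKETS SERVED FROM [4] THEOREM 3.3 BY NAME.**  From
`B9.Thm33Printed c35 geo bg Gp GA` for a [B9] frame reading the `ℤᵈ` data, Proposition 6 in [4]'s shape and the four `E(Ω₀)`-binders of B8 p. 86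
AT THE MEMBERS OF THE CUBE SUB-FAMILY ONLY (`DictAt`, `Prop6At`, `InvAt`, `CurvAt`, `LandauAt`, `AvgAt` relativized to `Subtype.val` — law-abiding
members, so the hypothesis set is satisfiable by print's objects whenever [4] Sect. A + Thm 3.3 hold there), the window `80d + 8 ≤ dL − 1`,
and a Proposition-5 constant `B₀′ > 0` with thresholds `cP, cu > 0`: THERE IS `B₀ > 0` (Theorem 3.3's) such that, writing `B₀ᴰ = max{1, 2B₀max{1,q}}`,
Proposition 5's three sockets at `(B₀ᴰ, B₀′, cP, cu)` on the cube sub-family of (1.131) give `c₁ > 0` with `B8.Prop6Printed d L (5dL·B₀ᴰ) c₁` on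
`zdCub ∘ f` for every cube index `f : ι′ → ZdIdx d L`.  The Theorem-4-frame socket `SH59D` on the cube sub-family and the four-line
Prop.-3-frame socket at every cube of `f` — the two remaining binders of `prop6Printed_zdCub_bdry₅_d4` — are DISCHARGED BY NAME from the
junction (`sockB9P3D4_allLevels_of_thm33_on` over the cube sub-family index, `sockH59D_of_allLevelsD4`); `B_∂ = (20d+2)B₀ᴰ`.
[cite: Balaban1985RegularSpaces, Prop. 6 p.99, Thm 4 p.88, Prop. 3 p.87, Prop. 5 (1.107)–(1.109) p.94, (1.58)–(1.59) p.86, (1.131) p.99; Balaban1985BackgroundPropagators, Thm 3.3 p.399, (3.27) p.395] -/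
theorem prop6Printed_zdCub_of_thm33 (hd2 : 2 ≤ d) {L : ℕ} (hL : 2 ≤ L) (hL81 : 80 * (d : ℝ) + 8 ≤ (d : ℝ) * L - 1)
    {I : Type} (geo : I → B9.Geometry) (bg : I → B9.Backgrounds) (GA : ∀ i, B9.KernelFamily (geo i) (bg i))
    (mem : ℝ → ZdIdx d L → ℕ → I)
    (ιCfg : ∀ (M : ℝ) (i : ZdIdx d L) (m : ℕ) (U₀ : Site d → Fin d → 𝔸ˣ), (∀ x κ, U₀ x κ ∈ unitaryUnits 𝔸) → (bg (mem M i m)).Cfg)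
    (ιLoc : ∀ (M : ℝ) (i : ZdIdx d L) (m : ℕ), (Site d → Fin d → 𝔸) → (geo (mem M i m)).Loc)
    (ops : ℝ → ZdIdx d L → ℕ → OpsZd d 𝔸) {c35 c₆ K₆ M₃ a₃ c69 q : ℝ}
    {Gp : ∀ i, B9.KernelFamily (geo i) (bg i)} (h33 : B9.Thm33Printed c35 geo bg Gp GA)
    -- the [4]-letter binders of printed shape AT THE MEMBERS OF THE CUBE SUB-FAMILY ONLY (n06-b's member-local `…At` forms)
    (hdict : ∀ (M : ℝ) (j : {i : ZdIdx d L // ∃ (a : Site d) (M ρ : ℕ), L ≤ ρ ∧ ρ ≤ M ∧ 11 * d < M ∧ L ≤ d * M ∧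
          i.Ω = cubeFam false L a M ρ i.k ∧ i.Λs = cubeLamS L a M ρ i.k ∧ i.Λb = cubeLamB L a M ρ i.k}) (m : ℕ),
      DictAt geo bg GA L mem ιCfg ιLoc ops M j.1 m)
    (hP6 : ∀ (M : ℝ) (j : {i : ZdIdx d L // ∃ (a : Site d) (M ρ : ℕ), L ≤ ρ ∧ ρ ≤ M ∧ 11 * d < M ∧ L ≤ d * M ∧
          i.Ω = cubeFam false L a M ρ i.k ∧ i.Λs = cubeLamS L a M ρ i.k ∧ i.Λb = cubeLamB L a M ρ i.k}) (m : ℕ),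
      M₃ ≤ M → Prop6At bg L mem ιCfg c35 c₆ K₆ M j.1 m)
    (hinv : ∀ (M : ℝ) (j : {i : ZdIdx d L // ∃ (a : Site d) (M ρ : ℕ), L ≤ ρ ∧ ρ ≤ M ∧ 11 * d < M ∧ L ≤ d * M ∧
          i.Ω = cubeFam false L a M ρ i.k ∧ i.Λs = cubeLamS L a M ρ i.k ∧ i.Λb = cubeLamB L a M ρ i.k}) (m : ℕ),
      M₃ ≤ M → InvAt bg L mem ιCfg ops c35 a₃ M j.1 m)
    (hcurv : ∀ (M : ℝ) (j : {i : ZdIdx d L // ∃ (a : Site d) (M ρ : ℕ), L ≤ ρ ∧ ρ ≤ M ∧ 11 * d < M ∧ L ≤ d * M ∧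
          i.Ω = cubeFam false L a M ρ i.k ∧ i.Λs = cubeLamS L a M ρ i.k ∧ i.Λb = cubeLamB L a M ρ i.k}) (m : ℕ),
      M₃ ≤ M → CurvAt bg L mem ιCfg ops c35 a₃ c69 M j.1 m)
    (hlan : ∀ (M : ℝ) (j : {i : ZdIdx d L // ∃ (a : Site d) (M ρ : ℕ), L ≤ ρ ∧ ρ ≤ M ∧ 11 * d < M ∧ L ≤ d * M ∧
          i.Ω = cubeFam false L a M ρ i.k ∧ i.Λs = cubeLamS L a M ρ i.k ∧ i.Λb = cubeLamB L a M ρ i.k}) (m : ℕ),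
      M₃ ≤ M → LandauAt bg L mem ιCfg ops c35 a₃ M j.1 m)
    (havg : ∀ (M : ℝ) (j : {i : ZdIdx d L // ∃ (a : Site d) (M ρ : ℕ), L ≤ ρ ∧ ρ ≤ M ∧ 11 * d < M ∧ L ≤ d * M ∧
          i.Ω = cubeFam false L a M ρ i.k ∧ i.Λs = cubeLamS L a M ρ i.k ∧ i.Λb = cubeLamB L a M ρ i.k}) (m : ℕ),
      AvgAt L ops q M j.1 m)
    (hc₆ : 0 < c₆) (hK₆ : 0 < K₆) (ha₃ : 0 < a₃) (hc69 : 0 ≤ c69) (hq : 0 ≤ q)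
    {B₀' C₂ cu cP : ℝ} (hB₀' : 0 < B₀') (hC₂ : 2097152 * ((d : ℝ) + 1) ^ 2 ≤ C₂) (hcu : 0 < cu) (hcP : 0 < cP) :
    ∃ B₀ : ℝ, 0 < B₀ ∧
      ((∀ i : {i : ZdIdx d L // ∃ (a : Site d) (M ρ : ℕ), L ≤ ρ ∧ ρ ≤ M ∧ 11 * d < M ∧ L ≤ d * M ∧
          i.Ω = cubeFam false L a M ρ i.k ∧ i.Λs = cubeLamS L a M ρ i.k ∧ i.Λb = cubeLamB L a M ρ i.k},
          SockP5base (𝔸 := 𝔸) L (max 1 (2 * B₀ * max 1 q)) B₀' cP i.1.η i.1.k i.1.Ω i.1.Λs) →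
       (∀ i : {i : ZdIdx d L // ∃ (a : Site d) (M ρ : ℕ), L ≤ ρ ∧ ρ ≤ M ∧ 11 * d < M ∧ L ≤ d * M ∧
          i.Ω = cubeFam false L a M ρ i.k ∧ i.Λs = cubeLamS L a M ρ i.k ∧ i.Λb = cubeLamB L a M ρ i.k},
          SockP5 (𝔸 := 𝔸) L (max 1 (2 * B₀ * max 1 q)) B₀' cP i.1.η i.1.k i.1.Ω i.1.Λs) →
       (∀ i : {i : ZdIdx d L // ∃ (a : Site d) (M ρ : ℕ), L ≤ ρ ∧ ρ ≤ M ∧ 11 * d < M ∧ L ≤ d * M ∧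
          i.Ω = cubeFam false L a M ρ i.k ∧ i.Λs = cubeLamS L a M ρ i.k ∧ i.Λb = cubeLamB L a M ρ i.k},
          SockP5u (𝔸 := 𝔸) L cP cu i.1.η i.1.k i.1.Ω i.1.Λs) →
       ∃ c₁ : ℝ, 0 < c₁ ∧ ∀ {ι' : Type} (f : ι' → ZdIdx d L),
         B8.Prop6Printed d (L : ℝ) (5 * (d : ℝ) * L * max 1 (2 * B₀ * max 1 q)) c₁ (fun j => zdCub 𝔸 L (f j))) := by
  have hL1 : 1 ≤ L := le_trans (by norm_num) hL
  have hd1 : 1 ≤ d := le_trans (by norm_num) hd2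
  have hLr : (2 : ℝ) ≤ L := by exact_mod_cast hL
  have hdr : (2 : ℝ) ≤ d := by exact_mod_cast hd2
  -- the cube members have `Margin2` (ρ ≥ L ≥ 2)
  have hMJ : ∀ i : {i : ZdIdx d L // ∃ (a : Site d) (M ρ : ℕ), L ≤ ρ ∧ ρ ≤ M ∧ 11 * d < M ∧ L ≤ d * M ∧
      i.Ω = cubeFam false L a M ρ i.k ∧ i.Λs = cubeLamS L a M ρ i.k ∧ i.Λb = cubeLamB L a M ρ i.k}, Margin2 i.1.Ω := by
    rintro ⟨i, a, M, ρ, hρ, -, -, -, hΩ, -, -⟩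
    dsimp only
    rw [hΩ]
    exact margin2_cubeFam L a M (hL.trans hρ) i.k
  -- ONE call of the junction over the CUBE SUB-FAMILY index (law-abiding members only): the four-line socket at every member, every level
  obtain ⟨B₀, cP9, hB₀, hcP9, hall⟩ := sockB9P3D4_allLevels_of_thm33_on geo bg GA L mem ιCfg ιLoc ops hd2 hL1 h33
    (Subtype.val : {i : ZdIdx d L // ∃ (a : Site d) (M ρ : ℕ), L ≤ ρ ∧ ρ ≤ M ∧ 11 * d < M ∧ L ≤ d * M ∧
      i.Ω = cubeFam false L a M ρ i.k ∧ i.Λs = cubeLamS L a M ρ i.k ∧ i.Λb = cubeLamB L a M ρ i.k} → ZdIdx d L) hMJ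
    hdict hP6 hinv hcurv hlan havg hc₆ hK₆ ha₃ hc69 hq
  refine ⟨B₀, hB₀, fun SP5base SP5 SP5u => ?_⟩
  set B₀D : ℝ := max 1 (2 * B₀ * max 1 q) with hB₀D_def
  have hB₀D1 : 1 ≤ B₀D := le_max_left _ _
  have hB₀D : 0 < B₀D := lt_of_lt_of_le one_pos hB₀D1
  -- the Proposition-5 ∕ b9 input pair of this seat's consumers
  obtain ⟨inp, hinp, hinp'⟩ : ∃ inp : B8.B9Inputs, inp.B₀ = B₀D ∧ inp.B₀' = B₀' := ⟨⟨B₀D, B₀', hB₀D, hB₀'⟩, rfl, rfl⟩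
  -- the consumer's standing conditions at `B₀ᴰ ≥ 1`
  have hB : 2 ≤ 5 * (d : ℝ) * L * inp.B₀ := by
    rw [hinp]
    have h1 : (2 : ℝ) ≤ 5 * (d : ℝ) * L := by nlinarith [hLr, hdr]
    nlinarith [h1, hB₀D1]
  have hBbd : 0 ≤ (20 * (d : ℝ) + 2) * B₀D := by positivity
  have hBd : 4 * ((20 * (d : ℝ) + 2) * B₀D) ≤ ((d : ℝ) * L - 1) * inp.B₀ := by
    rw [hinp]
    have h1 : 4 * (20 * (d : ℝ) + 2) ≤ (d : ℝ) * L - 1 := by linarith [hL81]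
    nlinarith [h1, hB₀D]
  -- the merged threshold
  set c59 : ℝ := min cP9 (cP9 / (2 * (L * (5 * (d : ℝ) * L * B₀D)) + 8 * (8 * B₀' * (5 * (d : ℝ) * L * B₀D)))) with hc59_def
  have hK₀ : 0 < 2 * (L * (5 * (d : ℝ) * L * B₀D)) + 8 * (8 * B₀' * (5 * (d : ℝ) * L * B₀D)) := by
    have h1 : 0 < 2 * (L * (5 * (d : ℝ) * L * B₀D)) := by positivity
    have h2 : 0 ≤ 8 * (8 * B₀' * (5 * (d : ℝ) * L * B₀D)) := by positivity
    linarith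
  have hc59 : 0 < c59 := lt_min hcP9 (div_pos hcP9 hK₀)
  set cPs : ℝ := min cP c59 with hcPs_def
  have hcPs : 0 < cPs := lt_min hcP hc59
  have hcPsP : cPs ≤ cP := min_le_left _ _
  have hcPs9 : cPs ≤ c59 := min_le_right _ _
  -- the consumer (this seat's `prop6Printed_zdCub_bdry₅_d4`) with `SH59D` served by the junction's bridge
  obtain ⟨c₁, hc₁, G⟩ := prop6Printed_zdCub_bdry₅_d4 (𝔸 := 𝔸) hd2 hL inp (C₂ := C₂) (cB9 := cP9) (cu := cu) (cP := cPs)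
    (Bbd := (20 * (d : ℝ) + 2) * B₀D) hB hC₂ hcP9 hcu hcPs hBbd hBd
    (fun i => by rw [hinp, hinp']; exact sockP5base_anti hcPsP (SP5base i))
    (fun i => by rw [hinp, hinp']; exact sockP5_anti hcPsP (SP5 i))
    (fun i α₀ α₁ hα₀ hα₁ hle => by
      rw [hinp, hinp']
      exact sockH59D_of_allLevelsD4 hd1 hL1 hB₀D hB₀'.le hcP9 (fun m hm => hall i m hm) α₀ α₁ hα₀ hα₁ (hle.trans hcPs9))
    (fun i => sockP5u_anti hcPsP (SP5u i))
  refine ⟨c₁, hc₁, fun f => ?_⟩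
  -- the cube of `f jf` IS a member of the cube sub-family (built field-by-field, n05-c's five laws); the socket there at `m := c.k`
  have hP := G f (fun jf c => by
    rw [hinp]
    exact hall ⟨⟨(f jf).η, (f jf).hη, c.k, c.one_le_k, cubeFam false L c.a c.M c.ρ c.k, hΩ_cubeFam hL1 c.a c.M c.L_le_ρ c.k,
      cubeLamS L c.a c.M c.ρ c.k, cubeLamB L c.a c.M c.ρ c.k, hbox_cubeLamB L c.a c.M c.ρ c.k, hclass_cubeLamB L c.a c.M c.ρ c.k,
      htower_cubeLam hL1 c.a c.M c.ρ c.k, hpart_cubeLam hL1 c.a c.M c.ρ c.k⟩,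
      ⟨c.a, c.M, c.ρ, c.L_le_ρ, c.ρ_le_M, c.big, c.L_le_dM, rfl, rfl, rfl⟩⟩ c.k le_rfl)
  rw [hinp] at hP
  exact hP

#print axioms prop6Printed_zdCub_of_thm33

/-- ★ **PROPOSITION 6 ON NODE 00's MEMBER OF RECORD `Node00.cubB8OfRecord θ`, BOTH (1.59) SOCKETS SERVED FROM [4] THEOREM 3.3 BY NAME** — the
record-facing form of `prop6Printed_zdCub_of_thm33` (`f := Subtype.val` on `Node00.IdxB8 θ`, coefficient algebra `θ.𝔸`, `d := θ.D`, `L := θ.L`):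
the `p6` letter of the record knits from `B9.Thm33Printed` + the six member-local `E(Ω₀)`-binders on the cube sub-family + Proposition 5's three sockets at
`(B₀ᴰ, B₀′)` + the window `80d + 8 ≤ dL − 1`; constant `B₁ = 5dL·B₀ᴰ` (monotone consumers: `Node00.prop6Printed_zdCub_mono`).
[cite: Balaban1985RegularSpaces, Prop. 6 p.99, Thm 4 p.88, Prop. 3 p.87, Prop. 5 p.94, (1.59) p.86; Balaban1985BackgroundPropagators, Thm 3.3 p.399] -/
theorem prop6Printed_cubB8OfRecord_of_thm33 (θ : Node00.Stage3Params) (hD : 2 ≤ θ.D) (hL81 : 80 * (θ.D : ℝ) + 8 ≤ (θ.D : ℝ) * θ.L - 1)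
    {I : Type} (geo : I → B9.Geometry) (bg : I → B9.Backgrounds) (GA : ∀ i, B9.KernelFamily (geo i) (bg i))
    (mem : ℝ → ZdIdx θ.D θ.L → ℕ → I)
    (ιCfg : ∀ (M : ℝ) (i : ZdIdx θ.D θ.L) (m : ℕ) (U₀ : Site θ.D → Fin θ.D → θ.𝔸ˣ), (∀ x κ, U₀ x κ ∈ unitaryUnits θ.𝔸) →
      (bg (mem M i m)).Cfg)
    (ιLoc : ∀ (M : ℝ) (i : ZdIdx θ.D θ.L) (m : ℕ), (Site θ.D → Fin θ.D → θ.𝔸) → (geo (mem M i m)).Loc)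
    (ops : ℝ → ZdIdx θ.D θ.L → ℕ → OpsZd θ.D θ.𝔸) {c35 c₆ K₆ M₃ a₃ c69 q : ℝ}
    {Gp : ∀ i, B9.KernelFamily (geo i) (bg i)} (h33 : B9.Thm33Printed c35 geo bg Gp GA)
    (hdict : ∀ (M : ℝ) (j : {i : ZdIdx θ.D θ.L // ∃ (a : Site θ.D) (M ρ : ℕ), θ.L ≤ ρ ∧ ρ ≤ M ∧ 11 * θ.D < M ∧ θ.L ≤ θ.D * M ∧
          i.Ω = cubeFam false θ.L a M ρ i.k ∧ i.Λs = cubeLamS θ.L a M ρ i.k ∧ i.Λb = cubeLamB θ.L a M ρ i.k}) (m : ℕ),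
      DictAt geo bg GA θ.L mem ιCfg ιLoc ops M j.1 m)
    (hP6 : ∀ (M : ℝ) (j : {i : ZdIdx θ.D θ.L // ∃ (a : Site θ.D) (M ρ : ℕ), θ.L ≤ ρ ∧ ρ ≤ M ∧ 11 * θ.D < M ∧ θ.L ≤ θ.D * M ∧
          i.Ω = cubeFam false θ.L a M ρ i.k ∧ i.Λs = cubeLamS θ.L a M ρ i.k ∧ i.Λb = cubeLamB θ.L a M ρ i.k}) (m : ℕ),
      M₃ ≤ M → Prop6At bg θ.L mem ιCfg c35 c₆ K₆ M j.1 m)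
    (hinv : ∀ (M : ℝ) (j : {i : ZdIdx θ.D θ.L // ∃ (a : Site θ.D) (M ρ : ℕ), θ.L ≤ ρ ∧ ρ ≤ M ∧ 11 * θ.D < M ∧ θ.L ≤ θ.D * M ∧
          i.Ω = cubeFam false θ.L a M ρ i.k ∧ i.Λs = cubeLamS θ.L a M ρ i.k ∧ i.Λb = cubeLamB θ.L a M ρ i.k}) (m : ℕ),
      M₃ ≤ M → InvAt bg θ.L mem ιCfg ops c35 a₃ M j.1 m)
    (hcurv : ∀ (M : ℝ) (j : {i : ZdIdx θ.D θ.L // ∃ (a : Site θ.D) (M ρ : ℕ), θ.L ≤ ρ ∧ ρ ≤ M ∧ 11 * θ.D < M ∧ θ.L ≤ θ.D * M ∧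
          i.Ω = cubeFam false θ.L a M ρ i.k ∧ i.Λs = cubeLamS θ.L a M ρ i.k ∧ i.Λb = cubeLamB θ.L a M ρ i.k}) (m : ℕ),
      M₃ ≤ M → CurvAt bg θ.L mem ιCfg ops c35 a₃ c69 M j.1 m)
    (hlan : ∀ (M : ℝ) (j : {i : ZdIdx θ.D θ.L // ∃ (a : Site θ.D) (M ρ : ℕ), θ.L ≤ ρ ∧ ρ ≤ M ∧ 11 * θ.D < M ∧ θ.L ≤ θ.D * M ∧
          i.Ω = cubeFam false θ.L a M ρ i.k ∧ i.Λs = cubeLamS θ.L a M ρ i.k ∧ i.Λb = cubeLamB θ.L a M ρ i.k}) (m : ℕ),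
      M₃ ≤ M → LandauAt bg θ.L mem ιCfg ops c35 a₃ M j.1 m)
    (havg : ∀ (M : ℝ) (j : {i : ZdIdx θ.D θ.L // ∃ (a : Site θ.D) (M ρ : ℕ), θ.L ≤ ρ ∧ ρ ≤ M ∧ 11 * θ.D < M ∧ θ.L ≤ θ.D * M ∧
          i.Ω = cubeFam false θ.L a M ρ i.k ∧ i.Λs = cubeLamS θ.L a M ρ i.k ∧ i.Λb = cubeLamB θ.L a M ρ i.k}) (m : ℕ),
      AvgAt θ.L ops q M j.1 m)
    (hc₆ : 0 < c₆) (hK₆ : 0 < K₆) (ha₃ : 0 < a₃) (hc69 : 0 ≤ c69) (hq : 0 ≤ q)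
    {B₀' C₂ cu cP : ℝ} (hB₀' : 0 < B₀') (hC₂ : 2097152 * ((θ.D : ℝ) + 1) ^ 2 ≤ C₂) (hcu : 0 < cu) (hcP : 0 < cP) :
    ∃ B₀ : ℝ, 0 < B₀ ∧
      ((∀ i : {i : ZdIdx θ.D θ.L // ∃ (a : Site θ.D) (M ρ : ℕ), θ.L ≤ ρ ∧ ρ ≤ M ∧ 11 * θ.D < M ∧ θ.L ≤ θ.D * M ∧
          i.Ω = cubeFam false θ.L a M ρ i.k ∧ i.Λs = cubeLamS θ.L a M ρ i.k ∧ i.Λb = cubeLamB θ.L a M ρ i.k},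
          SockP5base (𝔸 := θ.𝔸) θ.L (max 1 (2 * B₀ * max 1 q)) B₀' cP i.1.η i.1.k i.1.Ω i.1.Λs) →
       (∀ i : {i : ZdIdx θ.D θ.L // ∃ (a : Site θ.D) (M ρ : ℕ), θ.L ≤ ρ ∧ ρ ≤ M ∧ 11 * θ.D < M ∧ θ.L ≤ θ.D * M ∧
          i.Ω = cubeFam false θ.L a M ρ i.k ∧ i.Λs = cubeLamS θ.L a M ρ i.k ∧ i.Λb = cubeLamB θ.L a M ρ i.k},
          SockP5 (𝔸 := θ.𝔸) θ.L (max 1 (2 * B₀ * max 1 q)) B₀' cP i.1.η i.1.k i.1.Ω i.1.Λs) →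
       (∀ i : {i : ZdIdx θ.D θ.L // ∃ (a : Site θ.D) (M ρ : ℕ), θ.L ≤ ρ ∧ ρ ≤ M ∧ 11 * θ.D < M ∧ θ.L ≤ θ.D * M ∧
          i.Ω = cubeFam false θ.L a M ρ i.k ∧ i.Λs = cubeLamS θ.L a M ρ i.k ∧ i.Λb = cubeLamB θ.L a M ρ i.k},
          SockP5u (𝔸 := θ.𝔸) θ.L cP cu i.1.η i.1.k i.1.Ω i.1.Λs) →
       ∃ c₁ : ℝ, 0 < c₁ ∧
         B8.Prop6Printed θ.D (θ.L : ℝ) (5 * (θ.D : ℝ) * θ.L * max 1 (2 * B₀ * max 1 q)) c₁ (Node00.cubB8OfRecord θ)) := by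
  obtain ⟨B₀, hB₀, H⟩ := prop6Printed_zdCub_of_thm33 (𝔸 := θ.𝔸) hD θ.two_le_L hL81 geo bg GA mem ιCfg ιLoc ops h33 hdict hP6 hinv
    hcurv hlan havg hc₆ hK₆ ha₃ hc69 hq hB₀' hC₂ hcu hcP
  refine ⟨B₀, hB₀, fun SP5base SP5 SP5u => ?_⟩
  obtain ⟨c₁, hc₁, G⟩ := H SP5base SP5 SP5u
  exact ⟨c₁, hc₁, G (fun i : Node00.IdxB8 θ => i.1)⟩

#print axioms prop6Printed_cubB8OfRecord_of_thm33

/-! ## The same WITHOUT the «L large» window: enlarge the b9 constant instead (the four-line socket is monotone in `B₀`) -/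

omit [Nontrivial 𝔸] in
/-- The four-line collar socket `SockB9P3D4` (dag-n06-b) is MONOTONE in its constant `B₀`: its right-hand sides are `B₀·(|J|₍₋₃₎ + |B₁|) + B_∂Φ₀`
with `|J|₍₋₃₎ + |B₁| ≥ 0`. [cite: Balaban1985RegularSpaces, (1.59) p.86] -/
theorem sockB9P3D4_mono_B₀ {L : ℕ} {B₀ B₀s Bbd cP : ℝ} (hB : B₀ ≤ B₀s) {η : ℝ} (hη : 0 ≤ η) {k : ℕ} {Ω : ℕ → Set (Site d)}
    {Λs : ℕ → ℕ → Set (Site d)} {Λb : ℕ → ℕ → Set (Site d × Fin d)} (S : SockB9P3D4 (𝔸 := 𝔸) L B₀ Bbd cP η k Ω Λs Λb) :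
    SockB9P3D4 (𝔸 := 𝔸) L B₀s Bbd cP η k Ω Λs Λb := by
  intro α₀ α₂ hα₀ hα₀c hα₂ hα₂c U₀ W hU₀ hW hA hAW hLan A' hsa hWA hA0
  obtain ⟨l₁, l₂, l₃, l₄⟩ := S α₀ α₂ hα₀ hα₀c hα₂ hα₂c U₀ W hU₀ hW hA hAW hLan A' hsa hWA hA0
  have hX : 0 ≤ B8ScaledSupNorm.bondNorm L k η (-(3 : ℝ)) Ω (fun x μ => B8Eq155JBound.Jcur η U₀ A' μ x)
      + B8Eq155JBound.wsup 1 (fun p : {p : ℕ × (Site d × Fin d) // p.1 ≤ k ∧ p.2 ∈ Λb k p.1} =>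
          B7Prop4GeneralLevels.linCovIter L U₀ (B8Eq146AExpansion.iEta η A') p.1.1 p.1.2.1 p.1.2.2) :=
    add_nonneg (B8ScaledSupNorm.msup_nonneg L k hη _ _ _) (B8Eq155JBound.wsup_nonneg zero_le_one _)
  have hmono := mul_le_mul_of_nonneg_right hB hX
  exact ⟨l₁.trans (by linarith), l₂.trans (by linarith), l₃.trans (by linarith), l₄.trans (by linarith)⟩

/-- ★★ **PROPOSITION 6 ON THE CUBE MEMBERS FROM [4] THEOREM 3.3 BY NAME — WITHOUT THE «`L` LARGE» WINDOW.**  `prop6Printed_zdCub_of_thm33` carries the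
tree's exterior-bookkeeping window `80d + 8 ≤ dL − 1` because the collar allowance `B_∂ = (20d+2)B₀ᴰ` is absorbed in the slack of (1.60) ⇒ (1.62) only
under `4B_∂ ≤ (dL − 1)·B₀`.  Print has no such window — and none is needed: the four-line socket is MONOTONE in `B₀` (`sockB9P3D4_mono_B₀`), so the
junction's socket at `B₀ᴰ` is also a socket at the ENLARGED constant `B₀ˢ = B₀ᴰ·max{1, (80d+8)/(dL−1)}`, for which `4B_∂ ≤ (dL − 1)B₀ˢ` holds identically.
Running the consumers at `B₀ˢ` gives the same conclusion with `B₁ = 5dL·B₀ˢ` (print: «B₁ = 5dLB₀ … depend on d and L only», p. 87; the record's consumers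
are monotone in `B₁`, `Node00.prop6Printed_zdCub_mono`) and Proposition 5's sockets asked at `(B₀ˢ, B₀′)`.  NO hypothesis beyond print's shape remains
except the named ones.  [cite: Balaban1985RegularSpaces, Prop. 6 p.99, Prop. 3 p.87, Thm 4 p.88, Prop. 5 p.94, (1.58)–(1.62) pp.86–87; Balaban1985BackgroundPropagators, Thm 3.3 p.399] -/
theorem prop6Printed_zdCub_of_thm33' (hd2 : 2 ≤ d) {L : ℕ} (hL : 2 ≤ L)
    {I : Type} (geo : I → B9.Geometry) (bg : I → B9.Backgrounds) (GA : ∀ i, B9.KernelFamily (geo i) (bg i))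
    (mem : ℝ → ZdIdx d L → ℕ → I)
    (ιCfg : ∀ (M : ℝ) (i : ZdIdx d L) (m : ℕ) (U₀ : Site d → Fin d → 𝔸ˣ), (∀ x κ, U₀ x κ ∈ unitaryUnits 𝔸) → (bg (mem M i m)).Cfg)
    (ιLoc : ∀ (M : ℝ) (i : ZdIdx d L) (m : ℕ), (Site d → Fin d → 𝔸) → (geo (mem M i m)).Loc)
    (ops : ℝ → ZdIdx d L → ℕ → OpsZd d 𝔸) {c35 c₆ K₆ M₃ a₃ c69 q : ℝ}
    {Gp : ∀ i, B9.KernelFamily (geo i) (bg i)} (h33 : B9.Thm33Printed c35 geo bg Gp GA)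
    -- the [4]-letter binders of printed shape AT THE MEMBERS OF THE CUBE SUB-FAMILY ONLY (n06-b's member-local `…At` forms)
    (hdict : ∀ (M : ℝ) (j : {i : ZdIdx d L // ∃ (a : Site d) (M ρ : ℕ), L ≤ ρ ∧ ρ ≤ M ∧ 11 * d < M ∧ L ≤ d * M ∧
          i.Ω = cubeFam false L a M ρ i.k ∧ i.Λs = cubeLamS L a M ρ i.k ∧ i.Λb = cubeLamB L a M ρ i.k}) (m : ℕ),
      DictAt geo bg GA L mem ιCfg ιLoc ops M j.1 m)
    (hP6 : ∀ (M : ℝ) (j : {i : ZdIdx d L // ∃ (a : Site d) (M ρ : ℕ), L ≤ ρ ∧ ρ ≤ M ∧ 11 * d < M ∧ L ≤ d * M ∧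
          i.Ω = cubeFam false L a M ρ i.k ∧ i.Λs = cubeLamS L a M ρ i.k ∧ i.Λb = cubeLamB L a M ρ i.k}) (m : ℕ),
      M₃ ≤ M → Prop6At bg L mem ιCfg c35 c₆ K₆ M j.1 m)
    (hinv : ∀ (M : ℝ) (j : {i : ZdIdx d L // ∃ (a : Site d) (M ρ : ℕ), L ≤ ρ ∧ ρ ≤ M ∧ 11 * d < M ∧ L ≤ d * M ∧
          i.Ω = cubeFam false L a M ρ i.k ∧ i.Λs = cubeLamS L a M ρ i.k ∧ i.Λb = cubeLamB L a M ρ i.k}) (m : ℕ),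
      M₃ ≤ M → InvAt bg L mem ιCfg ops c35 a₃ M j.1 m)
    (hcurv : ∀ (M : ℝ) (j : {i : ZdIdx d L // ∃ (a : Site d) (M ρ : ℕ), L ≤ ρ ∧ ρ ≤ M ∧ 11 * d < M ∧ L ≤ d * M ∧
          i.Ω = cubeFam false L a M ρ i.k ∧ i.Λs = cubeLamS L a M ρ i.k ∧ i.Λb = cubeLamB L a M ρ i.k}) (m : ℕ),
      M₃ ≤ M → CurvAt bg L mem ιCfg ops c35 a₃ c69 M j.1 m)
    (hlan : ∀ (M : ℝ) (j : {i : ZdIdx d L // ∃ (a : Site d) (M ρ : ℕ), L ≤ ρ ∧ ρ ≤ M ∧ 11 * d < M ∧ L ≤ d * M ∧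
          i.Ω = cubeFam false L a M ρ i.k ∧ i.Λs = cubeLamS L a M ρ i.k ∧ i.Λb = cubeLamB L a M ρ i.k}) (m : ℕ),
      M₃ ≤ M → LandauAt bg L mem ιCfg ops c35 a₃ M j.1 m)
    (havg : ∀ (M : ℝ) (j : {i : ZdIdx d L // ∃ (a : Site d) (M ρ : ℕ), L ≤ ρ ∧ ρ ≤ M ∧ 11 * d < M ∧ L ≤ d * M ∧
          i.Ω = cubeFam false L a M ρ i.k ∧ i.Λs = cubeLamS L a M ρ i.k ∧ i.Λb = cubeLamB L a M ρ i.k}) (m : ℕ),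
      AvgAt L ops q M j.1 m)
    (hc₆ : 0 < c₆) (hK₆ : 0 < K₆) (ha₃ : 0 < a₃) (hc69 : 0 ≤ c69) (hq : 0 ≤ q)
    {B₀' C₂ cu cP : ℝ} (hB₀' : 0 < B₀') (hC₂ : 2097152 * ((d : ℝ) + 1) ^ 2 ≤ C₂) (hcu : 0 < cu) (hcP : 0 < cP) :
    ∃ B₀ : ℝ, 0 < B₀ ∧
      ((∀ i : {i : ZdIdx d L // ∃ (a : Site d) (M ρ : ℕ), L ≤ ρ ∧ ρ ≤ M ∧ 11 * d < M ∧ L ≤ d * M ∧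
          i.Ω = cubeFam false L a M ρ i.k ∧ i.Λs = cubeLamS L a M ρ i.k ∧ i.Λb = cubeLamB L a M ρ i.k},
          SockP5base (𝔸 := 𝔸) L ((max 1 (2 * B₀ * max 1 q) * max 1 ((80 * (d : ℝ) + 8) / ((d : ℝ) * L - 1)))) B₀' cP i.1.η i.1.k i.1.Ω i.1.Λs) →
       (∀ i : {i : ZdIdx d L // ∃ (a : Site d) (M ρ : ℕ), L ≤ ρ ∧ ρ ≤ M ∧ 11 * d < M ∧ L ≤ d * M ∧
          i.Ω = cubeFam false L a M ρ i.k ∧ i.Λs = cubeLamS L a M ρ i.k ∧ i.Λb = cubeLamB L a M ρ i.k},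
          SockP5 (𝔸 := 𝔸) L ((max 1 (2 * B₀ * max 1 q) * max 1 ((80 * (d : ℝ) + 8) / ((d : ℝ) * L - 1)))) B₀' cP i.1.η i.1.k i.1.Ω i.1.Λs) →
       (∀ i : {i : ZdIdx d L // ∃ (a : Site d) (M ρ : ℕ), L ≤ ρ ∧ ρ ≤ M ∧ 11 * d < M ∧ L ≤ d * M ∧
          i.Ω = cubeFam false L a M ρ i.k ∧ i.Λs = cubeLamS L a M ρ i.k ∧ i.Λb = cubeLamB L a M ρ i.k},
          SockP5u (𝔸 := 𝔸) L cP cu i.1.η i.1.k i.1.Ω i.1.Λs) →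
       ∃ c₁ : ℝ, 0 < c₁ ∧ ∀ {ι' : Type} (f : ι' → ZdIdx d L),
         B8.Prop6Printed d (L : ℝ) (5 * (d : ℝ) * L * (max 1 (2 * B₀ * max 1 q) * max 1 ((80 * (d : ℝ) + 8) / ((d : ℝ) * L - 1)))) c₁ (fun j => zdCub 𝔸 L (f j))) := by
  have hL1 : 1 ≤ L := le_trans (by norm_num) hL
  have hd1 : 1 ≤ d := le_trans (by norm_num) hd2
  have hLr : (2 : ℝ) ≤ L := by exact_mod_cast hL
  have hdr : (2 : ℝ) ≤ d := by exact_mod_cast hd2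
  have hdL : (0 : ℝ) < (d : ℝ) * L - 1 := by nlinarith [hLr, hdr]
  -- the cube members have `Margin2` (ρ ≥ L ≥ 2)
  have hMJ : ∀ i : {i : ZdIdx d L // ∃ (a : Site d) (M ρ : ℕ), L ≤ ρ ∧ ρ ≤ M ∧ 11 * d < M ∧ L ≤ d * M ∧
      i.Ω = cubeFam false L a M ρ i.k ∧ i.Λs = cubeLamS L a M ρ i.k ∧ i.Λb = cubeLamB L a M ρ i.k}, Margin2 i.1.Ω := by
    rintro ⟨i, a, M, ρ, hρ, -, -, -, hΩ, -, -⟩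
    dsimp only
    rw [hΩ]
    exact margin2_cubeFam L a M (hL.trans hρ) i.k
  -- ONE call of the junction over the cube sub-family index
  obtain ⟨B₀, cP9, hB₀, hcP9, hall⟩ := sockB9P3D4_allLevels_of_thm33_on geo bg GA L mem ιCfg ιLoc ops hd2 hL1 h33
    (Subtype.val : {i : ZdIdx d L // ∃ (a : Site d) (M ρ : ℕ), L ≤ ρ ∧ ρ ≤ M ∧ 11 * d < M ∧ L ≤ d * M ∧
      i.Ω = cubeFam false L a M ρ i.k ∧ i.Λs = cubeLamS L a M ρ i.k ∧ i.Λb = cubeLamB L a M ρ i.k} → ZdIdx d L) hMJ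
    hdict hP6 hinv hcurv hlan havg hc₆ hK₆ ha₃ hc69 hq
  refine ⟨B₀, hB₀, fun SP5base SP5 SP5u => ?_⟩
  set B₀D : ℝ := max 1 (2 * B₀ * max 1 q) with hB₀D_def
  have hB₀D1 : 1 ≤ B₀D := le_max_left _ _
  have hB₀D : 0 < B₀D := lt_of_lt_of_le one_pos hB₀D1
  -- the ENLARGED constant `B₀ˢ = B₀ᴰ·max{1, (80d+8)/(dL−1)}`
  set B₀S : ℝ := B₀D * max 1 ((80 * (d : ℝ) + 8) / ((d : ℝ) * L - 1)) with hB₀S_def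
  have hm1 : 1 ≤ max 1 ((80 * (d : ℝ) + 8) / ((d : ℝ) * L - 1)) := le_max_left _ _
  have hB₀S1 : 1 ≤ B₀S := by
    calc (1 : ℝ) = 1 * 1 := by ring
      _ ≤ B₀D * max 1 ((80 * (d : ℝ) + 8) / ((d : ℝ) * L - 1)) := mul_le_mul hB₀D1 hm1 zero_le_one hB₀D.le
  have hB₀S : 0 < B₀S := lt_of_lt_of_le one_pos hB₀S1
  have hDS : B₀D ≤ B₀S := by
    calc B₀D = B₀D * 1 := by ring
      _ ≤ B₀D * max 1 ((80 * (d : ℝ) + 8) / ((d : ℝ) * L - 1)) := mul_le_mul_of_nonneg_left hm1 hB₀D.le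
  obtain ⟨inp, hinp, hinp'⟩ : ∃ inp : B8.B9Inputs, inp.B₀ = B₀S ∧ inp.B₀' = B₀' := ⟨⟨B₀S, B₀', hB₀S, hB₀'⟩, rfl, rfl⟩
  have hB : 2 ≤ 5 * (d : ℝ) * L * inp.B₀ := by
    rw [hinp]
    have h1 : (2 : ℝ) ≤ 5 * (d : ℝ) * L := by nlinarith [hLr, hdr]
    nlinarith [h1, hB₀S1]
  have hBbd : 0 ≤ (20 * (d : ℝ) + 2) * B₀D := by positivity
  -- the absorption window holds IDENTICALLY at the enlarged constant
  have hBd : 4 * ((20 * (d : ℝ) + 2) * B₀D) ≤ ((d : ℝ) * L - 1) * inp.B₀ := by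
    rw [hinp, hB₀S_def]
    have h1 : (80 * (d : ℝ) + 8) / ((d : ℝ) * L - 1) ≤ max 1 ((80 * (d : ℝ) + 8) / ((d : ℝ) * L - 1)) := le_max_right _ _
    have h2 : ((d : ℝ) * L - 1) * ((80 * (d : ℝ) + 8) / ((d : ℝ) * L - 1)) = 80 * (d : ℝ) + 8 := by field_simp
    calc 4 * ((20 * (d : ℝ) + 2) * B₀D) = (((d : ℝ) * L - 1) * ((80 * (d : ℝ) + 8) / ((d : ℝ) * L - 1))) * B₀D := by rw [h2]; ring
      _ ≤ (((d : ℝ) * L - 1) * max 1 ((80 * (d : ℝ) + 8) / ((d : ℝ) * L - 1))) * B₀D :=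
          mul_le_mul_of_nonneg_right (mul_le_mul_of_nonneg_left h1 hdL.le) hB₀D.le
      _ = ((d : ℝ) * L - 1) * (B₀D * max 1 ((80 * (d : ℝ) + 8) / ((d : ℝ) * L - 1))) := by ring
  -- the junction's socket, moved to the enlarged constant
  have hallS : ∀ (j : {i : ZdIdx d L // ∃ (a : Site d) (M ρ : ℕ), L ≤ ρ ∧ ρ ≤ M ∧ 11 * d < M ∧ L ≤ d * M ∧
      i.Ω = cubeFam false L a M ρ i.k ∧ i.Λs = cubeLamS L a M ρ i.k ∧ i.Λb = cubeLamB L a M ρ i.k}) (m : ℕ), m ≤ j.1.k →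
      SockB9P3D4 (𝔸 := 𝔸) L B₀S ((20 * (d : ℝ) + 2) * B₀D) cP9 j.1.η m j.1.Ω j.1.Λs j.1.Λb :=
    fun j m hm => sockB9P3D4_mono_B₀ hDS (j.1.hη).le (hall j m hm)
  -- the merged threshold
  set c59 : ℝ := min cP9 (cP9 / (2 * (L * (5 * (d : ℝ) * L * B₀S)) + 8 * (8 * B₀' * (5 * (d : ℝ) * L * B₀S)))) with hc59_def
  have hK₀ : 0 < 2 * (L * (5 * (d : ℝ) * L * B₀S)) + 8 * (8 * B₀' * (5 * (d : ℝ) * L * B₀S)) := by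
    have h1 : 0 < 2 * (L * (5 * (d : ℝ) * L * B₀S)) := by positivity
    have h2 : 0 ≤ 8 * (8 * B₀' * (5 * (d : ℝ) * L * B₀S)) := by positivity
    linarith
  have hc59 : 0 < c59 := lt_min hcP9 (div_pos hcP9 hK₀)
  set cPs : ℝ := min cP c59 with hcPs_def
  have hcPs : 0 < cPs := lt_min hcP hc59
  have hcPsP : cPs ≤ cP := min_le_left _ _
  have hcPs9 : cPs ≤ c59 := min_le_right _ _
  obtain ⟨c₁, hc₁, G⟩ := prop6Printed_zdCub_bdry₅_d4 (𝔸 := 𝔸) hd2 hL inp (C₂ := C₂) (cB9 := cP9) (cu := cu) (cP := cPs)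
    (Bbd := (20 * (d : ℝ) + 2) * B₀D) hB hC₂ hcP9 hcu hcPs hBbd hBd
    (fun i => by rw [hinp, hinp']; exact sockP5base_anti hcPsP (SP5base i))
    (fun i => by rw [hinp, hinp']; exact sockP5_anti hcPsP (SP5 i))
    (fun i α₀ α₁ hα₀ hα₁ hle => by
      rw [hinp, hinp']
      exact sockH59D_of_allLevelsD4 hd1 hL1 hB₀S hB₀'.le hcP9 (fun m hm => hallS i m hm) α₀ α₁ hα₀ hα₁ (hle.trans hcPs9))
    (fun i => sockP5u_anti hcPsP (SP5u i))
  refine ⟨c₁, hc₁, fun f => ?_⟩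
  have hP := G f (fun jf c => by
    rw [hinp]
    exact hallS ⟨⟨(f jf).η, (f jf).hη, c.k, c.one_le_k, cubeFam false L c.a c.M c.ρ c.k, hΩ_cubeFam hL1 c.a c.M c.L_le_ρ c.k,
      cubeLamS L c.a c.M c.ρ c.k, cubeLamB L c.a c.M c.ρ c.k, hbox_cubeLamB L c.a c.M c.ρ c.k, hclass_cubeLamB L c.a c.M c.ρ c.k,
      htower_cubeLam hL1 c.a c.M c.ρ c.k, hpart_cubeLam hL1 c.a c.M c.ρ c.k⟩,
      ⟨c.a, c.M, c.ρ, c.L_le_ρ, c.ρ_le_M, c.big, c.L_le_dM, rfl, rfl, rfl⟩⟩ c.k le_rfl)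
  rw [hinp] at hP
  exact hP

#print axioms sockB9P3D4_mono_B₀
#print axioms prop6Printed_zdCub_of_thm33'

/-- ★ **THE WINDOW-FREE RECORD FORM**: `prop6Printed_zdCub_of_thm33'` on NODE 00's member of record `Node00.cubB8OfRecord θ` (`f := Subtype.val` on
`Node00.IdxB8 θ`): the `p6` letter of the record knits from `B9.Thm33Printed` + the six member-local `E(Ω₀)`-binders on the cube sub-family + Proposition 5's
three sockets at `(B₀ˢ, B₀′)`, `B₀ˢ = max{1, 2B₀max{1,q}}·max{1, (80d+8)/(dL−1)}` — NO «`L` large» window; constant `B₁ = 5dL·B₀ˢ`.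
[cite: Balaban1985RegularSpaces, Prop. 6 p.99, Thm 4 p.88, Prop. 3 p.87, Prop. 5 p.94, (1.59) p.86; Balaban1985BackgroundPropagators, Thm 3.3 p.399] -/
theorem prop6Printed_cubB8OfRecord_of_thm33' (θ : Node00.Stage3Params) (hD : 2 ≤ θ.D)
    {I : Type} (geo : I → B9.Geometry) (bg : I → B9.Backgrounds) (GA : ∀ i, B9.KernelFamily (geo i) (bg i))
    (mem : ℝ → ZdIdx θ.D θ.L → ℕ → I)
    (ιCfg : ∀ (M : ℝ) (i : ZdIdx θ.D θ.L) (m : ℕ) (U₀ : Site θ.D → Fin θ.D → θ.𝔸ˣ), (∀ x κ, U₀ x κ ∈ unitaryUnits θ.𝔸) →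
      (bg (mem M i m)).Cfg)
    (ιLoc : ∀ (M : ℝ) (i : ZdIdx θ.D θ.L) (m : ℕ), (Site θ.D → Fin θ.D → θ.𝔸) → (geo (mem M i m)).Loc)
    (ops : ℝ → ZdIdx θ.D θ.L → ℕ → OpsZd θ.D θ.𝔸) {c35 c₆ K₆ M₃ a₃ c69 q : ℝ}
    {Gp : ∀ i, B9.KernelFamily (geo i) (bg i)} (h33 : B9.Thm33Printed c35 geo bg Gp GA)
    (hdict : ∀ (M : ℝ) (j : {i : ZdIdx θ.D θ.L // ∃ (a : Site θ.D) (M ρ : ℕ), θ.L ≤ ρ ∧ ρ ≤ M ∧ 11 * θ.D < M ∧ θ.L ≤ θ.D * M ∧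
          i.Ω = cubeFam false θ.L a M ρ i.k ∧ i.Λs = cubeLamS θ.L a M ρ i.k ∧ i.Λb = cubeLamB θ.L a M ρ i.k}) (m : ℕ),
      DictAt geo bg GA θ.L mem ιCfg ιLoc ops M j.1 m)
    (hP6 : ∀ (M : ℝ) (j : {i : ZdIdx θ.D θ.L // ∃ (a : Site θ.D) (M ρ : ℕ), θ.L ≤ ρ ∧ ρ ≤ M ∧ 11 * θ.D < M ∧ θ.L ≤ θ.D * M ∧
          i.Ω = cubeFam false θ.L a M ρ i.k ∧ i.Λs = cubeLamS θ.L a M ρ i.k ∧ i.Λb = cubeLamB θ.L a M ρ i.k}) (m : ℕ),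
      M₃ ≤ M → Prop6At bg θ.L mem ιCfg c35 c₆ K₆ M j.1 m)
    (hinv : ∀ (M : ℝ) (j : {i : ZdIdx θ.D θ.L // ∃ (a : Site θ.D) (M ρ : ℕ), θ.L ≤ ρ ∧ ρ ≤ M ∧ 11 * θ.D < M ∧ θ.L ≤ θ.D * M ∧
          i.Ω = cubeFam false θ.L a M ρ i.k ∧ i.Λs = cubeLamS θ.L a M ρ i.k ∧ i.Λb = cubeLamB θ.L a M ρ i.k}) (m : ℕ),
      M₃ ≤ M → InvAt bg θ.L mem ιCfg ops c35 a₃ M j.1 m)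
    (hcurv : ∀ (M : ℝ) (j : {i : ZdIdx θ.D θ.L // ∃ (a : Site θ.D) (M ρ : ℕ), θ.L ≤ ρ ∧ ρ ≤ M ∧ 11 * θ.D < M ∧ θ.L ≤ θ.D * M ∧
          i.Ω = cubeFam false θ.L a M ρ i.k ∧ i.Λs = cubeLamS θ.L a M ρ i.k ∧ i.Λb = cubeLamB θ.L a M ρ i.k}) (m : ℕ),
      M₃ ≤ M → CurvAt bg θ.L mem ιCfg ops c35 a₃ c69 M j.1 m)
    (hlan : ∀ (M : ℝ) (j : {i : ZdIdx θ.D θ.L // ∃ (a : Site θ.D) (M ρ : ℕ), θ.L ≤ ρ ∧ ρ ≤ M ∧ 11 * θ.D < M ∧ θ.L ≤ θ.D * M ∧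
          i.Ω = cubeFam false θ.L a M ρ i.k ∧ i.Λs = cubeLamS θ.L a M ρ i.k ∧ i.Λb = cubeLamB θ.L a M ρ i.k}) (m : ℕ),
      M₃ ≤ M → LandauAt bg θ.L mem ιCfg ops c35 a₃ M j.1 m)
    (havg : ∀ (M : ℝ) (j : {i : ZdIdx θ.D θ.L // ∃ (a : Site θ.D) (M ρ : ℕ), θ.L ≤ ρ ∧ ρ ≤ M ∧ 11 * θ.D < M ∧ θ.L ≤ θ.D * M ∧
          i.Ω = cubeFam false θ.L a M ρ i.k ∧ i.Λs = cubeLamS θ.L a M ρ i.k ∧ i.Λb = cubeLamB θ.L a M ρ i.k}) (m : ℕ),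
      AvgAt θ.L ops q M j.1 m)
    (hc₆ : 0 < c₆) (hK₆ : 0 < K₆) (ha₃ : 0 < a₃) (hc69 : 0 ≤ c69) (hq : 0 ≤ q)
    {B₀' C₂ cu cP : ℝ} (hB₀' : 0 < B₀') (hC₂ : 2097152 * ((θ.D : ℝ) + 1) ^ 2 ≤ C₂) (hcu : 0 < cu) (hcP : 0 < cP) :
    ∃ B₀ : ℝ, 0 < B₀ ∧
      ((∀ i : {i : ZdIdx θ.D θ.L // ∃ (a : Site θ.D) (M ρ : ℕ), θ.L ≤ ρ ∧ ρ ≤ M ∧ 11 * θ.D < M ∧ θ.L ≤ θ.D * M ∧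
          i.Ω = cubeFam false θ.L a M ρ i.k ∧ i.Λs = cubeLamS θ.L a M ρ i.k ∧ i.Λb = cubeLamB θ.L a M ρ i.k},
          SockP5base (𝔸 := θ.𝔸) θ.L ((max 1 (2 * B₀ * max 1 q) * max 1 ((80 * (θ.D : ℝ) + 8) / ((θ.D : ℝ) * θ.L - 1)))) B₀' cP i.1.η i.1.k i.1.Ω i.1.Λs) →
       (∀ i : {i : ZdIdx θ.D θ.L // ∃ (a : Site θ.D) (M ρ : ℕ), θ.L ≤ ρ ∧ ρ ≤ M ∧ 11 * θ.D < M ∧ θ.L ≤ θ.D * M ∧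
          i.Ω = cubeFam false θ.L a M ρ i.k ∧ i.Λs = cubeLamS θ.L a M ρ i.k ∧ i.Λb = cubeLamB θ.L a M ρ i.k},
          SockP5 (𝔸 := θ.𝔸) θ.L ((max 1 (2 * B₀ * max 1 q) * max 1 ((80 * (θ.D : ℝ) + 8) / ((θ.D : ℝ) * θ.L - 1)))) B₀' cP i.1.η i.1.k i.1.Ω i.1.Λs) →
       (∀ i : {i : ZdIdx θ.D θ.L // ∃ (a : Site θ.D) (M ρ : ℕ), θ.L ≤ ρ ∧ ρ ≤ M ∧ 11 * θ.D < M ∧ θ.L ≤ θ.D * M ∧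
          i.Ω = cubeFam false θ.L a M ρ i.k ∧ i.Λs = cubeLamS θ.L a M ρ i.k ∧ i.Λb = cubeLamB θ.L a M ρ i.k},
          SockP5u (𝔸 := θ.𝔸) θ.L cP cu i.1.η i.1.k i.1.Ω i.1.Λs) →
       ∃ c₁ : ℝ, 0 < c₁ ∧
         B8.Prop6Printed θ.D (θ.L : ℝ) (5 * (θ.D : ℝ) * θ.L * (max 1 (2 * B₀ * max 1 q) * max 1 ((80 * (θ.D : ℝ) + 8) / ((θ.D : ℝ) * θ.L - 1)))) c₁ (Node00.cubB8OfRecord θ)) := by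
  obtain ⟨B₀, hB₀, H⟩ := prop6Printed_zdCub_of_thm33' (𝔸 := θ.𝔸) hD θ.two_le_L geo bg GA mem ιCfg ιLoc ops h33 hdict hP6 hinv
    hcurv hlan havg hc₆ hK₆ ha₃ hc69 hq hB₀' hC₂ hcu hcP
  refine ⟨B₀, hB₀, fun SP5base SP5 SP5u => ?_⟩
  obtain ⟨c₁, hc₁, G⟩ := H SP5base SP5 SP5u
  exact ⟨c₁, hc₁, G (fun i : Node00.IdxB8 θ => i.1)⟩

#print axioms prop6Printed_cubB8OfRecord_of_thm33'

/-! ## The binder-agnostic form: Proposition 6 on the cube members from ANY all-levels four-line socket family on the cube sub-family -/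

/-- ★★ **PROPOSITION 6 ON THE CUBE MEMBERS FROM AN ALL-LEVELS FOUR-LINE SOCKET FAMILY ON THE CUBE SUB-FAMILY — BINDER-AGNOSTIC, WINDOW-FREE.**
Whatever supplies, for SOME constants `B₀` (any real), `B_∂ ≥ 0`, `cP₉ > 0`, the four-line collar socket `SockB9P3D4 L B₀ B_∂ cP₉` at EVERY member of the
cube sub-family of (1.131) and EVERY truncation `m ≤ k` (today: dag-n06-b's junction from `B9.Thm33Printed` + member-local binders — in whatever
binder edition; tomorrow: anything else) gives, together with Proposition 5's three sockets at the ENLARGED constant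
`B₀ˢ = max{max{1, B₀}, 4B_∂/(dL − 1)}` (so that `B₀ ≤ B₀ˢ`, `1 ≤ B₀ˢ` and the absorption window `4B_∂ ≤ (dL − 1)B₀ˢ` hold identically — NO «`L` large»
proviso), a threshold `c₁ > 0` with `B8.Prop6Printed d L (5dL·B₀ˢ) c₁` on `zdCub ∘ f` for every cube index `f`.  This is the consumer side of the
N06 → N05 junction ISOLATED from the junction's hypothesis list: a re-typed junction plugs in by ONE application.  Proof: `sockB9P3D4_mono_B₀`,
`sockH59D_of_allLevelsD4`, the cube-of-`f` member term, thresholds merged by antitonicity, into `prop6Printed_zdCub_bdry₅_d4`.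
[cite: Balaban1985RegularSpaces, Prop. 6 p.99, Prop. 3 p.87, Thm 4 p.88, Prop. 5 p.94, (1.58)–(1.62) pp.86–87] -/
theorem prop6Printed_zdCub_of_sockD4Family (hd2 : 2 ≤ d) {L : ℕ} (hL : 2 ≤ L) {B₀ Bbd cP₉ B₀' C₂ cu cP : ℝ} (hBbd : 0 ≤ Bbd) (hcP₉ : 0 < cP₉) (hB₀' : 0 < B₀') (hC₂ : 2097152 * ((d : ℝ) + 1) ^ 2 ≤ C₂) (hcu : 0 < cu) (hcP : 0 < cP)
    (hall : ∀ (j : {i : ZdIdx d L // ∃ (a : Site d) (M ρ : ℕ), L ≤ ρ ∧ ρ ≤ M ∧ 11 * d < M ∧ L ≤ d * M ∧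
          i.Ω = cubeFam false L a M ρ i.k ∧ i.Λs = cubeLamS L a M ρ i.k ∧ i.Λb = cubeLamB L a M ρ i.k}) (m : ℕ), m ≤ j.1.k →
      SockB9P3D4 (𝔸 := 𝔸) L B₀ Bbd cP₉ j.1.η m j.1.Ω j.1.Λs j.1.Λb)
    (SP5base : ∀ i : {i : ZdIdx d L // ∃ (a : Site d) (M ρ : ℕ), L ≤ ρ ∧ ρ ≤ M ∧ 11 * d < M ∧ L ≤ d * M ∧
          i.Ω = cubeFam false L a M ρ i.k ∧ i.Λs = cubeLamS L a M ρ i.k ∧ i.Λb = cubeLamB L a M ρ i.k},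
      SockP5base (𝔸 := 𝔸) L (max (max 1 B₀) (4 * Bbd / ((d : ℝ) * L - 1))) B₀' cP i.1.η i.1.k i.1.Ω i.1.Λs)
    (SP5 : ∀ i : {i : ZdIdx d L // ∃ (a : Site d) (M ρ : ℕ), L ≤ ρ ∧ ρ ≤ M ∧ 11 * d < M ∧ L ≤ d * M ∧
          i.Ω = cubeFam false L a M ρ i.k ∧ i.Λs = cubeLamS L a M ρ i.k ∧ i.Λb = cubeLamB L a M ρ i.k},
      SockP5 (𝔸 := 𝔸) L (max (max 1 B₀) (4 * Bbd / ((d : ℝ) * L - 1))) B₀' cP i.1.η i.1.k i.1.Ω i.1.Λs)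
    (SP5u : ∀ i : {i : ZdIdx d L // ∃ (a : Site d) (M ρ : ℕ), L ≤ ρ ∧ ρ ≤ M ∧ 11 * d < M ∧ L ≤ d * M ∧
          i.Ω = cubeFam false L a M ρ i.k ∧ i.Λs = cubeLamS L a M ρ i.k ∧ i.Λb = cubeLamB L a M ρ i.k},
      SockP5u (𝔸 := 𝔸) L cP cu i.1.η i.1.k i.1.Ω i.1.Λs) :
    ∃ c₁ : ℝ, 0 < c₁ ∧ ∀ {ι' : Type} (f : ι' → ZdIdx d L),
      B8.Prop6Printed d (L : ℝ) (5 * (d : ℝ) * L * (max (max 1 B₀) (4 * Bbd / ((d : ℝ) * L - 1)))) c₁ (fun j => zdCub 𝔸 L (f j)) := by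
  have hL1 : 1 ≤ L := le_trans (by norm_num) hL
  have hd1 : 1 ≤ d := le_trans (by norm_num) hd2
  have hLr : (2 : ℝ) ≤ L := by exact_mod_cast hL
  have hdr : (2 : ℝ) ≤ d := by exact_mod_cast hd2
  have hdL : (0 : ℝ) < (d : ℝ) * L - 1 := by nlinarith [hLr, hdr]
  -- the ENLARGED constant
  set B₀S : ℝ := max (max 1 B₀) (4 * Bbd / ((d : ℝ) * L - 1)) with hB₀S_def
  have hB₀S1 : 1 ≤ B₀S := (le_max_left 1 B₀).trans (le_max_left _ _)
  have hB₀S : 0 < B₀S := lt_of_lt_of_le one_pos hB₀S1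
  have hDS : B₀ ≤ B₀S := (le_max_right 1 B₀).trans (le_max_left _ _)
  obtain ⟨inp, hinp, hinp'⟩ : ∃ inp : B8.B9Inputs, inp.B₀ = B₀S ∧ inp.B₀' = B₀' := ⟨⟨B₀S, B₀', hB₀S, hB₀'⟩, rfl, rfl⟩
  have hB : 2 ≤ 5 * (d : ℝ) * L * inp.B₀ := by
    rw [hinp]
    have h1 : (2 : ℝ) ≤ 5 * (d : ℝ) * L := by nlinarith [hLr, hdr]
    nlinarith [h1, hB₀S1]
  -- the absorption window holds IDENTICALLY at the enlarged constant
  have hBd : 4 * Bbd ≤ ((d : ℝ) * L - 1) * inp.B₀ := by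
    rw [hinp]
    have h1 : 4 * Bbd / ((d : ℝ) * L - 1) ≤ B₀S := le_max_right _ _
    have h2 : 4 * Bbd = ((d : ℝ) * L - 1) * (4 * Bbd / ((d : ℝ) * L - 1)) := by field_simp
    rw [h2]
    exact mul_le_mul_of_nonneg_left h1 hdL.le
  -- the socket family, moved to the enlarged constant
  have hallS : ∀ (j : {i : ZdIdx d L // ∃ (a : Site d) (M ρ : ℕ), L ≤ ρ ∧ ρ ≤ M ∧ 11 * d < M ∧ L ≤ d * M ∧
      i.Ω = cubeFam false L a M ρ i.k ∧ i.Λs = cubeLamS L a M ρ i.k ∧ i.Λb = cubeLamB L a M ρ i.k}) (m : ℕ), m ≤ j.1.k →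
      SockB9P3D4 (𝔸 := 𝔸) L B₀S Bbd cP₉ j.1.η m j.1.Ω j.1.Λs j.1.Λb :=
    fun j m hm => sockB9P3D4_mono_B₀ hDS (j.1.hη).le (hall j m hm)
  -- the merged threshold
  set c59 : ℝ := min cP₉ (cP₉ / (2 * (L * (5 * (d : ℝ) * L * B₀S)) + 8 * (8 * B₀' * (5 * (d : ℝ) * L * B₀S)))) with hc59_def
  have hK₀ : 0 < 2 * (L * (5 * (d : ℝ) * L * B₀S)) + 8 * (8 * B₀' * (5 * (d : ℝ) * L * B₀S)) := by
    have h1 : 0 < 2 * (L * (5 * (d : ℝ) * L * B₀S)) := by positivity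
    have h2 : 0 ≤ 8 * (8 * B₀' * (5 * (d : ℝ) * L * B₀S)) := by positivity
    linarith
  have hc59 : 0 < c59 := lt_min hcP₉ (div_pos hcP₉ hK₀)
  set cPs : ℝ := min cP c59 with hcPs_def
  have hcPs : 0 < cPs := lt_min hcP hc59
  have hcPsP : cPs ≤ cP := min_le_left _ _
  have hcPs9 : cPs ≤ c59 := min_le_right _ _
  obtain ⟨c₁, hc₁, G⟩ := prop6Printed_zdCub_bdry₅_d4 (𝔸 := 𝔸) hd2 hL inp (C₂ := C₂) (cB9 := cP₉) (cu := cu) (cP := cPs)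
    (Bbd := Bbd) hB hC₂ hcP₉ hcu hcPs hBbd hBd
    (fun i => by rw [hinp, hinp']; exact sockP5base_anti hcPsP (SP5base i))
    (fun i => by rw [hinp, hinp']; exact sockP5_anti hcPsP (SP5 i))
    (fun i α₀ α₁ hα₀ hα₁ hle => by
      rw [hinp, hinp']
      exact sockH59D_of_allLevelsD4 hd1 hL1 hB₀S hB₀'.le hcP₉ (fun m hm => hallS i m hm) α₀ α₁ hα₀ hα₁ (hle.trans hcPs9))
    (fun i => sockP5u_anti hcPsP (SP5u i))
  refine ⟨c₁, hc₁, fun f => ?_⟩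
  have hP := G f (fun jf c => by
    rw [hinp]
    exact hallS ⟨⟨(f jf).η, (f jf).hη, c.k, c.one_le_k, cubeFam false L c.a c.M c.ρ c.k, hΩ_cubeFam hL1 c.a c.M c.L_le_ρ c.k,
      cubeLamS L c.a c.M c.ρ c.k, cubeLamB L c.a c.M c.ρ c.k, hbox_cubeLamB L c.a c.M c.ρ c.k, hclass_cubeLamB L c.a c.M c.ρ c.k,
      htower_cubeLam hL1 c.a c.M c.ρ c.k, hpart_cubeLam hL1 c.a c.M c.ρ c.k⟩,
      ⟨c.a, c.M, c.ρ, c.L_le_ρ, c.ρ_le_M, c.big, c.L_le_dM, rfl, rfl, rfl⟩⟩ c.k le_rfl)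
  rw [hinp] at hP
  exact hP

#print axioms prop6Printed_zdCub_of_sockD4Family

end Literature.MathematicalPhysics.QuantumFieldTheory.Balaban1983to89.B8Prop6CubeMemberOfThm33

end
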